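import Summits.QuantumFields.GaugeBoot.TiltedBoxOddAxisWitness
import Summits.QuantumFields.GaugeBoot.TwistedSlabIntegral
import HarnessLib

/-!
# Axis reflection positivity FAILS on the square tilted box of ODD side, `d ≥ 3`, every `β > 0` (gauge-boot, L3 negative supplement)

HONEST FRAMING (cell `pub-gaugeboot`, page 1 of every file): the venture produces certified bounds
on lattice expectations at stated coupling, gauge group, dimension and torus size; NOT a mass gap,
NOT a continuum limit, NOT a string tension; NOT Yang–Mills-summit-bearing (barriers
`FixedCouplingUltralocality`, `PerturbativeInvisibility`). This module is a small NEGATIVE result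
about which positivity blocks a certificate on the tilted box may use; it discharges nothing else.

`TiltedBoxAxisRPNegative.lean` settles the square box of EVEN side: the layer `x_i ≡ P` is mapped to
itself, not pointwise, and a two-link odd observable refutes RP at every `β`. On the square box of
ODD side `M = 2P + 1` the flip `Θ_i : x_i ↦ -x_i` fixes the layer `x_i ≡ 0` POINTWISE and maps the
layer `P` onto the adjacent layer `P + 1` — a "hybrid frame" (site mirror + link mirror) which looked
positive. It is not: the link mirror is TWISTED (`Θ_i y = y + e_i + T`, `T = [M e_j] ≠ 0`,
`TiltedBoxOddAxisGeometry.lean`), and integrating out the crossing links the slab couples the layer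
`P` to the layer `P + 1` through a positive kernel composed with the translation by `T`. Test function
(`TiltedBoxOddAxisWitness.lean`): `F = (W_p - W_{p+T}) · exp(β ∑_q c_q (N - Re tr ρ(U_q)))` with `p` a
transverse plaquette of the layer `P` and `c_q` the half-space weights; then (this file)

  `∫ conj F(Θ_i U) F(U) dμ_β = -(C₀/Z) · z^{n-4} c_β⁴ · ∫ (W_p - W_{p+T})² dμ₀ < 0`

(`C₀, Z, z > 0`; `c_β > 0` the scalar of `∫ e^{β Re tr ρ} ρ`, `TwistedSlabHaar.lean`; the slab
integral of `TwistedSlabIntegral.lean` transfers the reflected plaquettes `p↑ + T`, `p↑` of the layer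
`P + 1` down to `p + T`, `p`, turning the pairing into `2⟨W_p W_{p+T}⟩ - ⟨W_p²⟩ - ⟨W_{p+T}²⟩`).

* **`tiltedBox_axisRP_neg_odd`** / **`not_tiltedBox_axisRP_odd`**: on `ℤ^d/Γ(2P+1, 2P+1, L)`,
  `P ≥ 1`, `L ≥ 2`, `d ≥ 3` (a direction `k ∉ {i, j}`), `i ≠ j`, for compact second countable `G`,
  continuous `ρ` with scalar commutant (`HasScalarCommutant`, e.g. an irreducible `ρ`), `N ≥ 1`,
  `ρ` non-trivial and EVERY `β > 0`, closed-half axis RP along `i` in the shape of `tiltedBox_siteRP`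
  (half `{0 ≤ x_i ≤ P (mod 2P+1)}` read through `axisHeight2`) FAILS. (At `β = 0` it holds trivially.)

With the even case: NO in-plane axis mirror of a square tilted box is of positive type in `d ≥ 3`.
In `d = 2` the twisted slab kernel depends on the layer only through its Polyakov loop, which is
`T`-invariant, and the hybrid frame IS positive, for every real `β` (`TiltedBoxOddAxisRPTwoDim.lean`,
`TiltedRP.TwoDim.tiltedBox_axisRP_odd_twoDim`). Small new negative; mechanism folklore (OS slabs).

References: J. Fröhlich, R. Israel, E. H. Lieb, B. Simon, J. Stat. Phys. 22 (1980) 297, §3;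
K. Osterwalder, E. Seiler, Ann. Phys. 110 (1978) 440, §2; M. Biskup, in LNM 1970 (2009) §5.5.
-/

noncomputable section

open MeasureTheory QuotientAddGroup
open scoped ComplexOrder ComplexConjugate
open Literature.MathematicalPhysics.QuantumFieldTheory (haarProbability)
open Literature.RepresentationTheory.CompactGroups

namespace Summit.QuantumFields.GaugeBoot

namespace TiltedRP

section Main

variable {d : ℕ} {i j : Fin d} {L P N : ℕ} [NeZero L] [NeZero P]
variable {G : Type*} [Group G] [TopologicalSpace G] [IsTopologicalGroup G] [CompactSpace G]
  [MeasurableSpace G] [BorelSpace G] [SecondCountableTopology G]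
variable (ρ : G →* Matrix (Fin N) (Fin N) ℂ) (q : DirPair d)

/-! ## The slab step: transferring a plaquette of the layer `P + 1` down to the layer `P` -/

omit [NeZero P] [CompactSpace G] [MeasurableSpace G] [BorelSpace G] [SecondCountableTopology G] in
/-- Continuity of the block weight product. [folklore] -/
theorem continuous_slabProd [DecidableEq (TiltedSite d i j (2 * P + 1) (2 * P + 1) L)]
    (hρ : Continuous ρ) (β : ℝ) :
    Continuous fun U : Config (TiltedSite d i j (2 * P + 1) (2 * P + 1) L) d G =>
      ∏ t ∈ slabBlock d i j L P, (TwistedSlab.wilsonWeight ρ β (slabA t U * (U t)⁻¹ * slabB t U) : ℂ) :=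
  continuous_finsetProd _ fun t _ => Complex.continuous_ofReal.comp
    ((TwistedSlab.continuous_wilsonWeight ρ hρ β).comp
      (((continuous_slabA t).mul (continuous_apply t).inv).mul (continuous_slabB t)))

/-- **The slab step.** For `x, y` in the layer `P` (so `x_i = P`):
`∫ W_x W_{y + e_i} ∏_{t∈block} w(a_t U_t⁻¹ b_t) dμ₀ = z^{n-4} c⁴ ∫ W_x W_y dμ₀` — the plaquette
`(y + e_i; q)` of the layer above the slab is transferred to `(y; q)`. [folklore] -/
theorem slab_step [DecidableEq (TiltedSite d i j (2 * P + 1) (2 * P + 1) L)]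
    (hq1 : q.1.1 ≠ i) (hq2 : q.1.2 ≠ i)
    (he1 : tiltedUnit d i j (2 * P + 1) (2 * P + 1) L q.1.1 ≠ 0)
    (he2 : tiltedUnit d i j (2 * P + 1) (2 * P + 1) L q.1.2 ≠ 0)
    (hρ : Continuous ρ) {β : ℝ} {c : ℂ}
    (hc : TwistedSlab.wAvg ρ (TwistedSlab.wilsonWeight ρ β) = c • (1 : Matrix (Fin N) (Fin N) ℂ))
    (x y : TiltedSite d i j (2 * P + 1) (2 * P + 1) L)
    (hx : axisCoord d L (2 * P + 1) x = ((P : ℕ) : ZMod (2 * P + 1)))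
    (hy : axisCoord d L (2 * P + 1) y = ((P : ℕ) : ZMod (2 * P + 1))) :
    ∫ U, ((oddW ρ q x U : ℝ) : ℂ) *
        ((oddW ρ q (y + tiltedUnit d i j (2 * P + 1) (2 * P + 1) L i) U : ℝ) : ℂ) *
        ∏ t ∈ slabBlock d i j L P, (TwistedSlab.wilsonWeight ρ β (slabA t U * (U t)⁻¹ * slabB t U) : ℂ)
        ∂(productHaar (TiltedSite d i j (2 * P + 1) (2 * P + 1) L) d G) =
      (∫ k, (TwistedSlab.wilsonWeight ρ β k : ℂ) ∂(haarProbability G)) ^ ((slabBlock d i j L P).card - 4) *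
        c ^ 4 * ∫ U, ((oddW ρ q x U : ℝ) : ℂ) * ((oddW ρ q y U : ℝ) : ℂ)
          ∂(productHaar (TiltedSite d i j (2 * P + 1) (2 * P + 1) L) d G) := by
  have hab : q.1.1 ≠ q.1.2 := ne_of_lt q.2
  -- the four links of the plaquette above
  have h0 : (y + tiltedUnit d i j (2 * P + 1) (2 * P + 1) L i, q.1.1) ∈ slabBlock d i j L P := by
    simpa using mem_slabBlock_above y hy q.1.1 hq1 0 (map_zero _)
  have h3 : (y + tiltedUnit d i j (2 * P + 1) (2 * P + 1) L i, q.1.2) ∈ slabBlock d i j L P := by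
    simpa using mem_slabBlock_above y hy q.1.2 hq2 0 (map_zero _)
  have h1 : (y + tiltedUnit d i j (2 * P + 1) (2 * P + 1) L i + tiltedUnit d i j (2 * P + 1) (2 * P + 1) L q.1.1,
      q.1.2) ∈ slabBlock d i j L P :=
    mem_slabBlock_above y hy q.1.2 hq2 _ (axisCoord_tiltedUnit_of_ne d L _ hq1)
  have h2 : (y + tiltedUnit d i j (2 * P + 1) (2 * P + 1) L i + tiltedUnit d i j (2 * P + 1) (2 * P + 1) L q.1.2,
      q.1.1) ∈ slabBlock d i j L P :=
    mem_slabBlock_above y hy q.1.1 hq1 _ (axisCoord_tiltedUnit_of_ne d L _ hq2)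
  have hne0 : ∀ (v w : TiltedSite d i j (2 * P + 1) (2 * P + 1) L) (m m' : Fin d), m ≠ m' →
      ((v, m) : Link _ d) ≠ (w, m') := fun v w m m' h hh => h (congrArg Prod.snd hh)
  have hy2 : y + tiltedUnit d i j (2 * P + 1) (2 * P + 1) L i ≠
      y + tiltedUnit d i j (2 * P + 1) (2 * P + 1) L i + tiltedUnit d i j (2 * P + 1) (2 * P + 1) L q.1.2 :=
    fun h => he2 (by simpa using h.symm)
  have hy1 : y + tiltedUnit d i j (2 * P + 1) (2 * P + 1) L i + tiltedUnit d i j (2 * P + 1) (2 * P + 1) L q.1.1 ≠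
      y + tiltedUnit d i j (2 * P + 1) (2 * P + 1) L i :=
    fun h => he1 (by simpa using h)
  have h := TwistedSlab.slab_integral_frozen ρ (TwistedSlab.continuous_wilsonWeight ρ hρ β)
    (TwistedSlab.wilsonWeight_inv ρ hρ β) hc hρ (slabBlock d i j L P) slabA slabB
    continuous_slabA continuous_slabB dependsOn_slabA dependsOn_slabB
    (fun U => ((oddW ρ q x U : ℝ) : ℂ)) (Complex.continuous_ofReal.comp (continuous_oddW ρ q hρ x))
    (fun U V hUV => congrArg _ (dependsOn_plaqObs_layer ρ (x, q) hx hq1 hq2 hUV))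
    h0 h1 h2 h3 (hne0 _ _ _ _ hab) (fun hh => hy2 (congrArg Prod.fst hh)) (hne0 _ _ _ _ hab)
    (hne0 _ _ _ _ hab.symm) (fun hh => hy1 (congrArg Prod.fst hh)) (hne0 _ _ _ _ hab)
  -- the plaquette above is `U t₀ U t₁ U t₂⁻¹ U t₃⁻¹`, the word below is `U_{(y; q)}`
  have hup : ∀ U : Config (TiltedSite d i j (2 * P + 1) (2 * P + 1) L) d G,
      oddW ρ q (y + tiltedUnit d i j (2 * P + 1) (2 * P + 1) L i) U =
        ((ρ (U (y + tiltedUnit d i j (2 * P + 1) (2 * P + 1) L i, q.1.1) *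
          U (y + tiltedUnit d i j (2 * P + 1) (2 * P + 1) L i + tiltedUnit d i j (2 * P + 1) (2 * P + 1) L q.1.1,
            q.1.2) *
          (U (y + tiltedUnit d i j (2 * P + 1) (2 * P + 1) L i + tiltedUnit d i j (2 * P + 1) (2 * P + 1) L q.1.2,
            q.1.1))⁻¹ *
          (U (y + tiltedUnit d i j (2 * P + 1) (2 * P + 1) L i, q.1.2))⁻¹)).trace).re := fun U => rfl
  have hdown := re_trace_slabWord ρ y hq1 hq2 hy
  simp_rw [hup]
  rw [h]
  congr 1
  refine integral_congr_ae (ae_of_all _ fun U => ?_)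
  dsimp only
  rw [hdown U]
  rfl

/-! ## The main computation -/

/-- `∫ (f - g - h + k) = ∫ f - ∫ g - ∫ h + ∫ k` (pointwise form). [folklore] -/
theorem integral_sub_sub_add {X : Type*} [MeasurableSpace X] {μ : Measure X} {f g h k : X → ℂ}
    (hf : Integrable f μ) (hg : Integrable g μ) (hh : Integrable h μ) (hk : Integrable k μ) :
    ∫ x, (f x - g x - h x + k x) ∂μ = ∫ x, f x ∂μ - ∫ x, g x ∂μ - ∫ x, h x ∂μ + ∫ x, k x ∂μ := by
  have h1 : ∫ x, (f x - g x - h x + k x) ∂μ = ∫ x, (f x - g x - h x) ∂μ + ∫ x, k x ∂μ :=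
    integral_add (f := fun x => f x - g x - h x) ((hf.sub hg).sub hh) hk
  have h2 : ∫ x, (f x - g x - h x) ∂μ = ∫ x, (f x - g x) ∂μ - ∫ x, h x ∂μ :=
    integral_sub (f := fun x => f x - g x) (hf.sub hg) hh
  rw [h1, h2, integral_sub hf hg]

omit [NeZero P] in
/-- Integrability of continuous integrands. [folklore] -/
theorem integrable_of_continuous_box {f : Config (TiltedSite d i j (2 * P + 1) (2 * P + 1) L) d G → ℂ}
    (hf : Continuous f) : Integrable f (productHaar (TiltedSite d i j (2 * P + 1) (2 * P + 1) L) d G) :=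
  TwistedSlab.integrable_config_of_continuous hf

/-- **Axis reflection positivity FAILS on the square tilted box of odd side, `β > 0`.** Box
`ℤ^d/Γ(2P+1, 2P+1, L)` (`P ≥ 1`, `L ≥ 1`, `i ≠ j`), `Θ_i = configReflect … i (tiltedAxisFlip …)`,
closed half `{0 ≤ x_i ≤ P (mod 2P+1)}` (through the doubled height `axisHeight2`); `q = (a, b)` a
transverse direction pair (`a, b ≠ i`) with `e_a, e_b ≠ 0` in the box; `G` compact second countable,
`ρ` continuous, non-trivial, with scalar commutant, `N ≥ 1`, `β > 0`. There is a bounded measurable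
half observable `F` with `∫ conj F(Θ_i U) · F(U) dμ_β < 0`. -/
theorem tiltedBox_axisRP_neg_odd (hij : i ≠ j) (hq1 : q.1.1 ≠ i) (hq2 : q.1.2 ≠ i)
    (he1 : tiltedUnit d i j (2 * P + 1) (2 * P + 1) L q.1.1 ≠ 0)
    (he2 : tiltedUnit d i j (2 * P + 1) (2 * P + 1) L q.1.2 ≠ 0)
    (hρ : Continuous ρ) (hirr : TwistedSlab.HasScalarCommutant ρ) (hN : 1 ≤ N) (hρ1 : ∃ g, ρ g ≠ 1)
    {β : ℝ} (hβ : 0 < β) :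
    ∃ F : Config (TiltedSite d i j (2 * P + 1) (2 * P + 1) L) d G → ℂ, Measurable F ∧
      (∃ C : ℝ, ∀ U, ‖F U‖ ≤ C) ∧
      IsHalfObservable (tiltedUnit d i j (2 * P + 1) (2 * P + 1) L) (2 * P + 1) (axisHeight2 d L (2 * P + 1)) F ∧
      ∫ U, conj (F (configReflect (tiltedUnit d i j (2 * P + 1) (2 * P + 1) L) i
          (tiltedAxisFlip d L (2 * P + 1) hij) U)) * F U
        ∂(gibbs ρ (tiltedUnit d i j (2 * P + 1) (2 * P + 1) L) β) < 0 := by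
  classical
  refine ⟨fun U => oddF ρ q β U, (continuous_oddF ρ q hρ β).measurable, exists_norm_oddF_le ρ q hρ β,
    isHalfObservable_oddF ρ q hij hq1 hq2 β, ?_⟩
  haveI := TwistedSlab.isProbabilityMeasure_productHaar'
    (A := TiltedSite d i j (2 * P + 1) (2 * P + 1) L) (d := d) (G := G)
  -- the constants
  obtain ⟨c, hcpos, hc⟩ := TwistedSlab.wAvg_wilsonWeight_eq_smul_pos ρ hirr hρ hβ hN
  have hzr : ∫ k, (TwistedSlab.wilsonWeight ρ β k : ℂ) ∂(haarProbability G) =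
      ((∫ k, TwistedSlab.wilsonWeight ρ β k ∂(haarProbability G) : ℝ) : ℂ) := integral_complex_ofReal
  have hzpos : 0 < ∫ k, TwistedSlab.wilsonWeight ρ β k ∂(haarProbability G) := by
    have hint : Integrable (TwistedSlab.wilsonWeight ρ β) (haarProbability G) :=
      (TwistedSlab.continuous_wilsonWeight ρ hρ β).integrable_of_hasCompactSupport
        (HasCompactSupport.of_compactSpace _)
    rw [integral_pos_iff_support_of_nonneg (fun k => (TwistedSlab.wilsonWeight_pos ρ β k).le) hint]
    have : Function.support (TwistedSlab.wilsonWeight ρ β) = Set.univ :=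
      Set.eq_univ_of_forall fun k => (TwistedSlab.wilsonWeight_pos ρ β k).ne'
    rw [this, measure_univ]; exact one_pos
  have hZ := normaliser_pos (A := TiltedSite d i j (2 * P + 1) (2 * P + 1) L) (G := G) ρ hρ
    (tiltedUnit d i j (2 * P + 1) (2 * P + 1) L) β
  set Z := ∫ U, Real.exp (-β * wilsonAction ρ (tiltedUnit d i j (2 * P + 1) (2 * P + 1) L) U)
    ∂(productHaar (TiltedSite d i j (2 * P + 1) (2 * P + 1) L) d G) with hZdef
  set C₀ : ℝ := ∏ _p ∈ Finset.univ.filter (IsSlabPlaq (P := P) (d := d) (i := i) (j := j) (L := L)),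
    Real.exp (-(β * N)) with hC₀
  have hC₀pos : 0 < C₀ := Finset.prod_pos fun _ _ => Real.exp_pos _
  have hsq := integral_oddDiff_sq_pos ρ q hij hq2 he2 hρ hρ1 (L := L)
  -- Step A: the integrand against the product Haar measure
  have hreal : ∀ U : Config (TiltedSite d i j (2 * P + 1) (2 * P + 1) L) d G,
      Real.exp (-β * wilsonAction ρ (tiltedUnit d i j (2 * P + 1) (2 * P + 1) L) U) / Z *
        (Real.exp (β * oddExpo ρ (configReflect (tiltedUnit d i j (2 * P + 1) (2 * P + 1) L) i
          (tiltedAxisFlip d L (2 * P + 1) hij) U)) * Real.exp (β * oddExpo ρ U)) =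
      C₀ / Z * ∏ t ∈ slabBlock d i j L P, TwistedSlab.wilsonWeight ρ β (slabA t U * (U t)⁻¹ * slabB t U) := by
    intro U
    have hexp : Real.exp (-β * wilsonAction ρ (tiltedUnit d i j (2 * P + 1) (2 * P + 1) L) U) *
        (Real.exp (β * oddExpo ρ (configReflect (tiltedUnit d i j (2 * P + 1) (2 * P + 1) L) i
          (tiltedAxisFlip d L (2 * P + 1) hij) U)) * Real.exp (β * oddExpo ρ U)) =
        C₀ * ∏ t ∈ slabBlock d i j L P, TwistedSlab.wilsonWeight ρ β (slabA t U * (U t)⁻¹ * slabB t U) := by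
      rw [← Real.exp_add, ← Real.exp_add,
        show -β * wilsonAction ρ (tiltedUnit d i j (2 * P + 1) (2 * P + 1) L) U +
          (β * oddExpo ρ (configReflect (tiltedUnit d i j (2 * P + 1) (2 * P + 1) L) i
            (tiltedAxisFlip d L (2 * P + 1) hij) U) + β * oddExpo ρ U) =
          β * (oddExpo ρ (configReflect (tiltedUnit d i j (2 * P + 1) (2 * P + 1) L) i
            (tiltedAxisFlip d L (2 * P + 1) hij) U) + oddExpo ρ U -
            wilsonAction ρ (tiltedUnit d i j (2 * P + 1) (2 * P + 1) L) U) by ring,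
        oddExpo_configReflect_add ρ hij hρ U, mul_neg, ← neg_mul, Finset.mul_sum, Real.exp_sum,
        ← prod_exp_slab_eq ρ hρ β U, hC₀, ← Finset.prod_mul_distrib]
      refine Finset.prod_congr rfl fun p _ => ?_
      rw [← Real.exp_add]; congr 1; ring
    rw [div_mul_eq_mul_div, hexp, mul_div_right_comm]
  have hA : ∫ U, conj (oddF ρ q β (configReflect (tiltedUnit d i j (2 * P + 1) (2 * P + 1) L) i
        (tiltedAxisFlip d L (2 * P + 1) hij) U)) * oddF ρ q β U
        ∂(gibbs ρ (tiltedUnit d i j (2 * P + 1) (2 * P + 1) L) β) =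
      ((C₀ / Z : ℝ) : ℂ) * ∫ U, ((oddDiff ρ q (configReflect (tiltedUnit d i j (2 * P + 1) (2 * P + 1) L) i
          (tiltedAxisFlip d L (2 * P + 1) hij) U) : ℝ) : ℂ) * ((oddDiff ρ q U : ℝ) : ℂ) *
          ∏ t ∈ slabBlock d i j L P, (TwistedSlab.wilsonWeight ρ β (slabA t U * (U t)⁻¹ * slabB t U) : ℂ)
          ∂(productHaar (TiltedSite d i j (2 * P + 1) (2 * P + 1) L) d G) := by
    rw [integral_gibbs, ← integral_const_mul]
    refine integral_congr_ae (ae_of_all _ fun U => ?_)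
    have h := congrArg (fun r : ℝ => (r : ℂ)) (hreal U)
    push_cast at h
    simp only [oddF, map_mul, Complex.conj_ofReal, Complex.real_smul]
    push_cast
    linear_combination (((oddDiff ρ q (configReflect (tiltedUnit d i j (2 * P + 1) (2 * P + 1) L) i
      (tiltedAxisFlip d L (2 * P + 1) hij) U) : ℝ) : ℂ) * ((oddDiff ρ q U : ℝ) : ℂ)) * h
  -- Step B: expand the differences and transfer the plaquettes above the slab down
  have hst := fun x y hx hy => slab_step ρ q hq1 hq2 he1 he2 hρ hc x y hx hy
  have hx0 : axisCoord d L (2 * P + 1) (oddLayerSite d i j L P) = ((P : ℕ) : ZMod (2 * P + 1)) :=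
    axisCoord_oddLayerSite
  have hxT : axisCoord d L (2 * P + 1) (oddLayerSite d i j L P + tiltedTwist d L (2 * P + 1)) =
      ((P : ℕ) : ZMod (2 * P + 1)) := axisCoord_oddLayerSite_add_twist hij
  -- integrability of the pieces
  have hWc : ∀ x, Continuous fun U : Config (TiltedSite d i j (2 * P + 1) (2 * P + 1) L) d G =>
      ((oddW ρ q x U : ℝ) : ℂ) := fun x => Complex.continuous_ofReal.comp (continuous_oddW ρ q hρ x)
  have hPc := continuous_slabProd (i := i) (j := j) (L := L) (P := P) ρ hρ β
  have hI3 : ∀ x y, Integrable (fun U => ((oddW ρ q x U : ℝ) : ℂ) * ((oddW ρ q y U : ℝ) : ℂ) *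
      ∏ t ∈ slabBlock d i j L P, (TwistedSlab.wilsonWeight ρ β (slabA t U * (U t)⁻¹ * slabB t U) : ℂ))
      (productHaar (TiltedSite d i j (2 * P + 1) (2 * P + 1) L) d G) :=
    fun x y => integrable_of_continuous_box (((hWc x).mul (hWc y)).mul hPc)
  have hI2 : ∀ x y, Integrable (fun U => ((oddW ρ q x U : ℝ) : ℂ) * ((oddW ρ q y U : ℝ) : ℂ))
      (productHaar (TiltedSite d i j (2 * P + 1) (2 * P + 1) L) d G) :=
    fun x y => integrable_of_continuous_box ((hWc x).mul (hWc y))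
  have hB : ∫ U, ((oddDiff ρ q (configReflect (tiltedUnit d i j (2 * P + 1) (2 * P + 1) L) i
          (tiltedAxisFlip d L (2 * P + 1) hij) U) : ℝ) : ℂ) * ((oddDiff ρ q U : ℝ) : ℂ) *
          ∏ t ∈ slabBlock d i j L P, (TwistedSlab.wilsonWeight ρ β (slabA t U * (U t)⁻¹ * slabB t U) : ℂ)
          ∂(productHaar (TiltedSite d i j (2 * P + 1) (2 * P + 1) L) d G) =
      -((∫ k, (TwistedSlab.wilsonWeight ρ β k : ℂ) ∂(haarProbability G)) ^ ((slabBlock d i j L P).card - 4) *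
        c ^ 4) * ((∫ U, oddDiff ρ q U ^ 2 ∂(productHaar (TiltedSite d i j (2 * P + 1) (2 * P + 1) L) d G) : ℝ) : ℂ) := by
    -- expand
    have hpt : ∀ U : Config (TiltedSite d i j (2 * P + 1) (2 * P + 1) L) d G,
        ((oddDiff ρ q (configReflect (tiltedUnit d i j (2 * P + 1) (2 * P + 1) L) i
          (tiltedAxisFlip d L (2 * P + 1) hij) U) : ℝ) : ℂ) * ((oddDiff ρ q U : ℝ) : ℂ) *
          ∏ t ∈ slabBlock d i j L P, (TwistedSlab.wilsonWeight ρ β (slabA t U * (U t)⁻¹ * slabB t U) : ℂ) =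
        ((oddW ρ q (oddLayerSite d i j L P) U : ℝ) : ℂ) *
            ((oddW ρ q (oddLayerSite d i j L P + tiltedTwist d L (2 * P + 1) +
              tiltedUnit d i j (2 * P + 1) (2 * P + 1) L i) U : ℝ) : ℂ) *
            ∏ t ∈ slabBlock d i j L P, (TwistedSlab.wilsonWeight ρ β (slabA t U * (U t)⁻¹ * slabB t U) : ℂ) -
          ((oddW ρ q (oddLayerSite d i j L P + tiltedTwist d L (2 * P + 1)) U : ℝ) : ℂ) *
            ((oddW ρ q (oddLayerSite d i j L P + tiltedTwist d L (2 * P + 1) +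
              tiltedUnit d i j (2 * P + 1) (2 * P + 1) L i) U : ℝ) : ℂ) *
            ∏ t ∈ slabBlock d i j L P, (TwistedSlab.wilsonWeight ρ β (slabA t U * (U t)⁻¹ * slabB t U) : ℂ) -
          ((oddW ρ q (oddLayerSite d i j L P) U : ℝ) : ℂ) *
            ((oddW ρ q (oddLayerSite d i j L P + tiltedUnit d i j (2 * P + 1) (2 * P + 1) L i) U : ℝ) : ℂ) *
            ∏ t ∈ slabBlock d i j L P, (TwistedSlab.wilsonWeight ρ β (slabA t U * (U t)⁻¹ * slabB t U) : ℂ) +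
          ((oddW ρ q (oddLayerSite d i j L P + tiltedTwist d L (2 * P + 1)) U : ℝ) : ℂ) *
            ((oddW ρ q (oddLayerSite d i j L P + tiltedUnit d i j (2 * P + 1) (2 * P + 1) L i) U : ℝ) : ℂ) *
            ∏ t ∈ slabBlock d i j L P, (TwistedSlab.wilsonWeight ρ β (slabA t U * (U t)⁻¹ * slabB t U) : ℂ) := by
      intro U
      rw [oddDiff_configReflect ρ q hij hq1 hq2 hρ U, oddDiff]
      push_cast
      ring
    simp_rw [hpt]
    rw [integral_sub_sub_add (hI3 _ _) (hI3 _ _) (hI3 _ _) (hI3 _ _),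
      hst _ _ hx0 hxT, hst _ _ hxT hxT, hst _ _ hx0 hx0, hst _ _ hxT hx0]
    -- `∫ D² = J(y₀,y₀) - J(y₀,y₀+T) - J(y₀+T,y₀) + J(y₀+T,y₀+T)`
    have hD2 : ((∫ U, oddDiff ρ q U ^ 2 ∂(productHaar (TiltedSite d i j (2 * P + 1) (2 * P + 1) L) d G) : ℝ) : ℂ) =
        ∫ U, ((oddW ρ q (oddLayerSite d i j L P) U : ℝ) : ℂ) * ((oddW ρ q (oddLayerSite d i j L P) U : ℝ) : ℂ)
            ∂(productHaar (TiltedSite d i j (2 * P + 1) (2 * P + 1) L) d G) -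
          ∫ U, ((oddW ρ q (oddLayerSite d i j L P) U : ℝ) : ℂ) *
            ((oddW ρ q (oddLayerSite d i j L P + tiltedTwist d L (2 * P + 1)) U : ℝ) : ℂ)
            ∂(productHaar (TiltedSite d i j (2 * P + 1) (2 * P + 1) L) d G) -
          ∫ U, ((oddW ρ q (oddLayerSite d i j L P + tiltedTwist d L (2 * P + 1)) U : ℝ) : ℂ) *
            ((oddW ρ q (oddLayerSite d i j L P) U : ℝ) : ℂ)
            ∂(productHaar (TiltedSite d i j (2 * P + 1) (2 * P + 1) L) d G) +
          ∫ U, ((oddW ρ q (oddLayerSite d i j L P + tiltedTwist d L (2 * P + 1)) U : ℝ) : ℂ) *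
            ((oddW ρ q (oddLayerSite d i j L P + tiltedTwist d L (2 * P + 1)) U : ℝ) : ℂ)
            ∂(productHaar (TiltedSite d i j (2 * P + 1) (2 * P + 1) L) d G) := by
      rw [← integral_complex_ofReal, ← integral_sub_sub_add (hI2 _ _) (hI2 _ _) (hI2 _ _) (hI2 _ _)]
      refine integral_congr_ae (ae_of_all _ fun U => ?_)
      simp only [oddDiff]
      push_cast
      ring
    rw [hD2]
    ring
  -- Step C: the sign
  rw [hA, hB, hzr]
  have hκ : 0 < (∫ k, TwistedSlab.wilsonWeight ρ β k ∂(haarProbability G)) ^ ((slabBlock d i j L P).card - 4) * c ^ 4 :=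
    mul_pos (pow_pos hzpos _) (pow_pos hcpos 4)
  have hfin : C₀ / Z * (-((∫ k, TwistedSlab.wilsonWeight ρ β k ∂(haarProbability G)) ^
      ((slabBlock d i j L P).card - 4) * c ^ 4) *
      ∫ U, oddDiff ρ q U ^ 2 ∂(productHaar (TiltedSite d i j (2 * P + 1) (2 * P + 1) L) d G)) < 0 :=
    mul_neg_of_pos_of_neg (div_pos hC₀pos hZ) (mul_neg_of_neg_of_pos (neg_neg_of_pos hκ) hsq)
  have hcast := Complex.real_lt_real.2 hfin
  push_cast at hcast
  simpa using hcast

/-! ## The corollary for `d ≥ 3` -/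

omit [NeZero L] [NeZero P] in
/-- `e_j ≠ 0` in the box. [folklore] -/
theorem tiltedUnit_right_ne_zero (hij : i ≠ j) :
    tiltedUnit d i j (2 * P + 1) (2 * P + 1) L j ≠ (0 : TiltedSite d i j (2 * P + 1) (2 * P + 1) L) := by
  intro h
  rw [tiltedUnit, QuotientAddGroup.eq_zero_iff, mem_tiltedLattice_iff] at h
  obtain ⟨h1, -, -⟩ := h
  simp only [Pi.single_eq_of_ne hij, Pi.single_eq_same, zero_add] at h1
  have h2 := Int.le_of_dvd one_pos h1
  push_cast at h2; omega

omit [NeZero L] [NeZero P] in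
/-- `e_k ≠ 0` in the box for `k ∉ {i, j}` and `L ≥ 2`. [folklore] -/
theorem tiltedUnit_other_ne_zero {k : Fin d} (hki : k ≠ i) (hkj : k ≠ j) (hL : 2 ≤ L) :
    tiltedUnit d i j (2 * P + 1) (2 * P + 1) L k ≠ (0 : TiltedSite d i j (2 * P + 1) (2 * P + 1) L) := by
  intro h
  rw [tiltedUnit, QuotientAddGroup.eq_zero_iff, mem_tiltedLattice_iff] at h
  obtain ⟨-, -, h3⟩ := h
  have h4 := h3 k hki hkj
  rw [Pi.single_eq_same] at h4
  have h5 := Int.le_of_dvd one_pos h4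
  omega

/-- **Corollary: closed-half axis reflection positivity, in the shape of `tiltedBox_siteRP`, is
FALSE along the axis `i` of the square tilted box of odd side `2P + 1` (`P ≥ 1`), in `d ≥ 3`
(a direction `k ∉ {i, j}`), with `L ≥ 2`, for every `β > 0`** — `G` compact second countable, `ρ`
continuous, non-trivial, with scalar commutant, `N ≥ 1`. With `not_tiltedBox_axisRP` (even side):
no in-plane axis flip of a square tilted box gives a PSD block in `d ≥ 3`. -/
theorem not_tiltedBox_axisRP_odd (hij : i ≠ j) {k : Fin d} (hki : k ≠ i) (hkj : k ≠ j) (hL : 2 ≤ L)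
    (hρ : Continuous ρ) (hirr : TwistedSlab.HasScalarCommutant ρ) (hN : 1 ≤ N) (hρ1 : ∃ g, ρ g ≠ 1)
    {β : ℝ} (hβ : 0 < β) :
    ¬ ∀ F : Config (TiltedSite d i j (2 * P + 1) (2 * P + 1) L) d G → ℂ, Measurable F →
        (∃ C : ℝ, ∀ U, ‖F U‖ ≤ C) →
        IsHalfObservable (tiltedUnit d i j (2 * P + 1) (2 * P + 1) L) (2 * P + 1) (axisHeight2 d L (2 * P + 1)) F →
        0 ≤ ∫ U, conj (F (configReflect (tiltedUnit d i j (2 * P + 1) (2 * P + 1) L) i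
          (tiltedAxisFlip d L (2 * P + 1) hij) U)) * F U
          ∂(gibbs ρ (tiltedUnit d i j (2 * P + 1) (2 * P + 1) L) β) := by
  intro hRP
  -- the transverse direction pair `{j, k}`
  have hq : ∃ q : DirPair d, q.1.1 ≠ i ∧ q.1.2 ≠ i ∧
      tiltedUnit d i j (2 * P + 1) (2 * P + 1) L q.1.1 ≠ 0 ∧ tiltedUnit d i j (2 * P + 1) (2 * P + 1) L q.1.2 ≠ 0 := by
    by_cases hjk : j < k
    · exact ⟨⟨(j, k), hjk⟩, hij.symm, hki, tiltedUnit_right_ne_zero hij, tiltedUnit_other_ne_zero hki hkj hL⟩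
    · exact ⟨⟨(k, j), lt_of_le_of_ne (not_lt.1 hjk) hkj⟩, hki, hij.symm, tiltedUnit_other_ne_zero hki hkj hL,
        tiltedUnit_right_ne_zero hij⟩
  obtain ⟨q, hq1, hq2, he1, he2⟩ := hq
  obtain ⟨F, hFm, hFb, hFo, hneg⟩ :=
    tiltedBox_axisRP_neg_odd (L := L) (P := P) ρ q hij hq1 hq2 he1 he2 hρ hirr hN hρ1 hβ
  exact lt_irrefl _ (lt_of_le_of_lt (hRP F hFm hFb hFo) hneg)

end Main

end TiltedRP

end Summit.QuantumFields.GaugeBoot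

end
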